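import Summits.Ventures.YMGap.Thresholds.ConnectedThreePointDecaySUN
import Summits.Ventures.YMGap.Thresholds.CouplingSecondDerivative
import Summits.Ventures.YMGap.Thresholds.CouplingContDiff
import HarnessLib

/-!
# Venture YMGap — C-DIFF2 FOR EVERY `SU(N)` (`d = 4`): the strong-coupling state is `C²` in the coupling, with
# `d²/db² ⟨F⟩_b = N² Σ_q Σ_r u₃(F; W_q; W_r)` — hypothesis-free for `N ≥ 2` at 't Hooft `0 < b/N < 9/308`

HONEST FRAMING: venture file of the cell `pub-ymgap` (QuantumFields programme), seat ds-1 (gen 10).  Strong-coupling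
LATTICE statement for `SU(N)` lattice Yang–Mills on `ℤ^4` with the Wilson action at tree coupling `b` (`W_q = (1/N) Re tr U_q`):
inside the one-sided vertex-star window fed by a one-link KR modulus (hypothesis-free instance: the Bakry–Émery modulus,
`b₁ = N·9/308`) the unique DLR state is TWICE continuously differentiable in the coupling on Lipschitz cylinder observables,
with second derivative `N²` times the absolutely convergent double plaquette sum of the connected three-point function;
`C²`, NOT analyticity; nothing about the continuum, confinement at weak coupling, or the Clay problem.  `SU(N)` twin of
`CouplingSecondDerivative` (g8's `hasDerivAt_integral_star_SU` + this seat's `summable_threePoint_SU` + Mathlib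
`hasDerivAt_tsum_of_isPreconnected`).

* `continuousOn_cov_star_SU`, `continuousOn_threePoint_SU` — continuity of covariances / of each `u₃` term on `[0, b₁]`;
* ★ `hasDerivAt_cov_plaquette_star_SU` — `d/db Cov_b(F, W_q) = N Σ_r u₃(F; W_q; W_r)`;
* ★★ `hasDerivAt_responseSum_star_SU` — `d/db Σ_q Cov_b(F, W_q) = Σ_q N Σ_r u₃(F; W_q; W_r)` on `(0, b₁)`;
* ★★ `hasDerivAt_deriv_integral_star_SU`, `continuousOn_threePointSum_SU`, ★★ `contDiffOn_two_integral_star_SU` —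
  `d²/db² ⟨F⟩_b = N Σ_q N Σ_r u₃` and `b ↦ ⟨F⟩_b` is `ContDiffOn ℝ 2` on `Ioo 0 b₁`;
* ★★ `hasDerivAt_deriv_integral_SU_thooft`, `contDiffOn_two_integral_SU_thooft`, `hasDerivAt_deriv_plaquette_SU_thooft` —
  EVERY `N ≥ 2`, HYPOTHESIS-FREE, on `(0, N·9/308)`.

References (mechanism only): B. Simon, *The Statistical Mechanics of Lattice Gases* I (1993), §II.12; R. L. Dobrushin,
S. B. Shlosman (1987).
-/

noncomputable section

open MeasureTheory ProbabilityTheory Function Finset Filter Topology Real Set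
open scoped NNReal
open Literature.MathematicalPhysics.QuantumLattice (LGConfig ZdEdge ZdPlaquette plaquetteEdges fundamentalRep
  ymGibbsMeasures)
open Literature.MathematicalPhysics.QuantumFieldTheory hiding ZdEdge
open Literature.MathematicalPhysics.QuantumFieldTheory.Balaban1983to89.StrongCouplingDobrushinWindow (OneLinkKRModulus)
open Literature.MathematicalPhysics.QuantumFieldTheory.Balaban1983to89.StrongCouplingKernelWindow (oneLinkKRModulus_SU)
open Summit.Ventures.YMGap.DSWindow (starRate starRate_pos)
open Summit.Ventures.YMGap.StarWindowGauge (gaugeR gaugeR_lt_one_of_le)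
open Summit.Ventures.YMGap.StarLemmaG (gaugeR_nonneg)
open Summit.Ventures.YMGap.RobustBall (l1 l1_sub_comm numOrient)
open Summit.Ventures.YMGap.LinearResponseBound (summable_and_tsum_base_le)

namespace Summit.Ventures.YMGap.CouplingResponse

variable {N : ℕ}

/-- Local shorthand: the normalised plaquette observable `W_q = (1/N) Re tr U_q` of `SU(N)` on `ℤ⁴`. -/
local notation3 (prettyPrint := false) "W∗" q:max =>
  zdPlaquetteObs (d := 4) (fundamentalRep (Fin N)) (Prod.fst q) (Prod.snd q).1.1 (Prod.snd q).1.2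

/-! ### §1 Continuity -/

section Continuity

/-- **Covariances of Lipschitz cylinders are continuous in the coupling** along any DLR selection on `[0, b₁]` (`SU(N)`,
modulus window). [folklore] -/
theorem continuousOn_cov_star_SU (hN : 1 ≤ N) {R K b₁ : ℝ} (hK0 : 0 ≤ K) (hmod : OneLinkKRModulus N R K)
    (hR : b₁ / N * 6 ≤ R) (h925 : 4 * (K * (b₁ / N)) ≤ 9 / 25)
    {μ : ℝ → Measure (LGConfig 4 (Matrix.specialUnitaryGroup (Fin N) ℂ))}
    (hμ : ∀ b ∈ Icc (0 : ℝ) b₁, μ b ∈ ymGibbsMeasures (d := 4) (fundamentalRep (Fin N)) b)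
    {X Y : LGConfig 4 (Matrix.specialUnitaryGroup (Fin N) ℂ) → ℝ} {Λ₁ Λ₂ : Finset (ZdEdge 4)}
    {K₁ K₂ M₁ M₂ : ℝ≥0}
    (hX : IsLipschitzCylinder (fundamentalRep (Fin N)) X Λ₁ K₁)
    (hY : IsLipschitzCylinder (fundamentalRep (Fin N)) Y Λ₂ K₂)
    (hM₁ : ∀ U, |X U| ≤ M₁) (hM₂ : ∀ U, |Y U| ≤ M₂)
    {x₀ : Literature.Probability.LatticeModels.Site 4} {D₁ D₂ : ℕ}
    (hD₁ : ∀ e ∈ Λ₁, ‖e.1 - x₀‖ ≤ D₁) (hD₂ : ∀ e ∈ Λ₂, ‖e.1 - x₀‖ ≤ D₂) :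
    ContinuousOn (fun b => cov[X, Y; μ b]) (Icc (0 : ℝ) b₁) := by
  classical
  have hXY := isLipschitzCylinder_mul hX hY hM₁ hM₂
  have c1 := continuousOn_integral_SU hN hK0 hmod hR h925 hμ hXY (union_norm_sub_le hD₁ hD₂)
  have c2 := continuousOn_integral_SU hN hK0 hmod hR h925 hμ hX hD₁
  have c3 := continuousOn_integral_SU hN hK0 hmod hR h925 hμ hY hD₂
  refine ((c1.sub (c2.mul c3)).congr fun b hb => ?_)
  haveI : IsProbabilityMeasure (μ b) := (hμ b hb).1
  exact covariance_eq_sub_of_abs_le hX.measurable hY.measurable hM₁ hM₂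

/-- **Each three-point term is continuous in the coupling** on `[0, b₁]` (`SU(N)`, modulus window). [folklore] -/
theorem continuousOn_threePoint_SU (hN : 1 ≤ N) {R K b₁ : ℝ} (hK0 : 0 ≤ K) (hmod : OneLinkKRModulus N R K)
    (hR : b₁ / N * 6 ≤ R) (h925 : 4 * (K * (b₁ / N)) ≤ 9 / 25)
    {μ : ℝ → Measure (LGConfig 4 (Matrix.specialUnitaryGroup (Fin N) ℂ))}
    (hμ : ∀ b ∈ Icc (0 : ℝ) b₁, μ b ∈ ymGibbsMeasures (d := 4) (fundamentalRep (Fin N)) b)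
    {F : LGConfig 4 (Matrix.specialUnitaryGroup (Fin N) ℂ) → ℝ} {Λ : Finset (ZdEdge 4)} {KF : ℝ≥0}
    (hF : IsLipschitzCylinder (fundamentalRep (Fin N)) F Λ KF)
    {x₀ : Literature.Probability.LatticeModels.Site 4} {D : ℕ} (hD : ∀ e ∈ Λ, ‖e.1 - x₀‖ ≤ D)
    (q r : ZdPlaquette 4) :
    ContinuousOn (fun b => cov[fun U => F U * (W∗ q) U, W∗ r; μ b] -
      (∫ U, F U ∂(μ b)) * cov[W∗ q, W∗ r; μ b] - (∫ U, (W∗ q) U ∂(μ b)) * cov[F, W∗ r; μ b])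
      (Icc (0 : ℝ) b₁) := by
  classical
  obtain ⟨hWq, -, hWq1, -, -⟩ := plaquetteObs_data_SU (N := N) q
  obtain ⟨hWr, -, hWr1, -, -⟩ := plaquetteObs_data_SU (N := N) r
  have hFM : ∀ U, |F U| ≤ ((⟨|F 1| + 2 * KF, by positivity⟩ : ℝ≥0) : ℝ) := fun U => hF.abs_le U
  have hDq := plaquetteEdges_norm_sub_le q x₀
  have hDr := plaquetteEdges_norm_sub_le r x₀
  have hFW := isLipschitzCylinder_mul hF hWq hFM hWq1
  have hFWb : ∀ U, |F U * (W∗ q) U| ≤ ((⟨|F 1| + 2 * KF, by positivity⟩ * 1 : ℝ≥0) : ℝ) := fun U => by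
    rw [abs_mul]; push_cast
    exact mul_le_mul (hFM U) (by simpa using hWq1 U) (abs_nonneg _) (by positivity)
  have c1 := continuousOn_cov_star_SU hN hK0 hmod hR h925 hμ hFW hWr hFWb hWr1 (union_norm_sub_le hD hDq) hDr
  have c2 := continuousOn_cov_star_SU hN hK0 hmod hR h925 hμ hWq hWr hWq1 hWr1 hDq hDr
  have c3 := continuousOn_cov_star_SU hN hK0 hmod hR h925 hμ hF hWr hFM hWr1 hD hDr
  have cF := continuousOn_integral_SU hN hK0 hmod hR h925 hμ hF hD
  have cW := continuousOn_integral_SU hN hK0 hmod hR h925 hμ hWq hDq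
  exact (c1.sub (cF.mul c2)).sub (cW.mul c3)

end Continuity

/-! ### §2 One term -/

section OneTerm

/-- ★ **The derivative of one response term, `SU(N)`**: under the modulus hypotheses, along any DLR selection on
`[0, b₁]`, for every Lipschitz cylinder `F`, plaquette `q` and `0 < b < b₁`:
`d/db Cov_{μ b}(F, W_q) = N · Σ_r u₃(F; W_q; W_r)_{μ b}` (g8's `hasDerivAt_integral_star_SU` for `F·W_q`, `F`, `W_q`,
product rule; the three response series converge absolutely). -/
theorem hasDerivAt_cov_plaquette_star_SU (hN : 1 ≤ N) {R K b₁ : ℝ} (hK0 : 0 ≤ K) (hmod : OneLinkKRModulus N R K)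
    (hR : b₁ / N * 6 ≤ R) (h925 : 4 * (K * (b₁ / N)) ≤ 9 / 25)
    {μ : ℝ → Measure (LGConfig 4 (Matrix.specialUnitaryGroup (Fin N) ℂ))}
    (hμ : ∀ b ∈ Icc (0 : ℝ) b₁, μ b ∈ ymGibbsMeasures (d := 4) (fundamentalRep (Fin N)) b)
    {F : LGConfig 4 (Matrix.specialUnitaryGroup (Fin N) ℂ) → ℝ} {Λ : Finset (ZdEdge 4)} {KF : ℝ≥0}
    (hF : IsLipschitzCylinder (fundamentalRep (Fin N)) F Λ KF)
    {x₀ : Literature.Probability.LatticeModels.Site 4} {D : ℕ} (hD : ∀ e ∈ Λ, ‖e.1 - x₀‖ ≤ D)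
    (q : ZdPlaquette 4) {b : ℝ} (hb : b ∈ Ioo (0 : ℝ) b₁) :
    HasDerivAt (fun t => cov[F, W∗ q; μ t])
      ((N : ℝ) * ∑' r : ZdPlaquette 4, (cov[fun U => F U * (W∗ q) U, W∗ r; μ b] -
        (∫ U, F U ∂(μ b)) * cov[W∗ q, W∗ r; μ b] - (∫ U, (W∗ q) U ∂(μ b)) * cov[F, W∗ r; μ b])) b := by
  classical
  obtain ⟨hWq, hWqm, hWq1, -, -⟩ := plaquetteObs_data_SU (N := N) q
  have hFM : ∀ U, |F U| ≤ ((⟨|F 1| + 2 * KF, by positivity⟩ : ℝ≥0) : ℝ) := fun U => hF.abs_le U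
  have hDq := plaquetteEdges_norm_sub_le q x₀
  have hFW := isLipschitzCylinder_mul hF hWq hFM hWq1
  have hbI : b ∈ Icc (0 : ℝ) b₁ := ⟨hb.1.le, hb.2.le⟩
  have d1 := hasDerivAt_integral_star_SU hN hK0 hmod hR h925 hμ hFW (union_norm_sub_le hD hDq) hb
  have d2 := hasDerivAt_integral_star_SU hN hK0 hmod hR h925 hμ hF hD hb
  have d3 := hasDerivAt_integral_star_SU hN hK0 hmod hR h925 hμ hWq hDq hb
  have d := d1.fun_sub (d2.fun_mul d3)
  have hev : (fun t => cov[F, W∗ q; μ t]) =ᶠ[𝓝 b]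
      fun t => (∫ U, F U * (W∗ q) U ∂(μ t)) - (∫ U, F U ∂(μ t)) * ∫ U, (W∗ q) U ∂(μ t) := by
    filter_upwards [Ioo_mem_nhds hb.1 hb.2] with t ht
    haveI : IsProbabilityMeasure (μ t) := (hμ t ⟨ht.1.le, ht.2.le⟩).1
    exact covariance_eq_sub_of_abs_le hF.measurable hWqm hFM hWq1
  refine (d.congr_of_eventuallyEq hev).congr_deriv ?_
  have s1 := summable_cov_plaquette_star_SU hN hK0 hmod hR h925 hbI.1 hbI.2 (hμ b hbI) hFW (union_norm_sub_le hD hDq)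
  have s2 := summable_cov_plaquette_star_SU hN hK0 hmod hR h925 hbI.1 hbI.2 (hμ b hbI) hF hD
  have s3 := summable_cov_plaquette_star_SU hN hK0 hmod hR h925 hbI.1 hbI.2 (hμ b hbI) hWq hDq
  have s3' := s3.mul_left (∫ U, F U ∂(μ b))
  have s2' := s2.mul_left (∫ U, (W∗ q) U ∂(μ b))
  rw [(s1.sub s3').tsum_sub s2', s1.tsum_sub s3', tsum_mul_left, tsum_mul_left]
  ring

end OneTerm

/-! ### §3 The response series is differentiable: `C²` in the coupling -/

section Series

/-- ★★ **THE RESPONSE SERIES IS DIFFERENTIABLE IN THE COUPLING, `SU(N)`** (modulus window): along any DLR selection on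
`[0, b₁]`, for every Lipschitz cylinder `F` and every `0 < b < b₁`:
`d/db Σ_q Cov_{μ b}(F, W_q) = Σ_q N·Σ_r u₃(F; W_q; W_r)_{μ b}` (termwise differentiation under the uniform summable
domination of `summable_threePoint_SU`). -/
theorem hasDerivAt_responseSum_star_SU (hN : 1 ≤ N) {R K b₁ : ℝ} (hK0 : 0 ≤ K) (hmod : OneLinkKRModulus N R K)
    (hR : b₁ / N * 6 ≤ R) (h925 : 4 * (K * (b₁ / N)) ≤ 9 / 25)
    {μ : ℝ → Measure (LGConfig 4 (Matrix.specialUnitaryGroup (Fin N) ℂ))}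
    (hμ : ∀ b ∈ Icc (0 : ℝ) b₁, μ b ∈ ymGibbsMeasures (d := 4) (fundamentalRep (Fin N)) b)
    {F : LGConfig 4 (Matrix.specialUnitaryGroup (Fin N) ℂ) → ℝ} {Λ : Finset (ZdEdge 4)} {KF : ℝ≥0}
    (hF : IsLipschitzCylinder (fundamentalRep (Fin N)) F Λ KF)
    {x₀ : Literature.Probability.LatticeModels.Site 4} {D : ℕ} (hD : ∀ e ∈ Λ, ‖e.1 - x₀‖ ≤ D)
    {b : ℝ} (hb : b ∈ Ioo (0 : ℝ) b₁) :
    HasDerivAt (fun t => ∑' q : ZdPlaquette 4, cov[F, W∗ q; μ t])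
      (∑' q : ZdPlaquette 4, (N : ℝ) * ∑' r : ZdPlaquette 4, (cov[fun U => F U * (W∗ q) U, W∗ r; μ b] -
        (∫ U, F U ∂(μ b)) * cov[W∗ q, W∗ r; μ b] - (∫ U, (W∗ q) U ∂(μ b)) * cov[F, W∗ r; μ b])) b := by
  classical
  have hN0 : (0 : ℝ) < N := by exact_mod_cast (show 0 < N by omega)
  have hβ₁0 : 0 ≤ b₁ := hb.1.le.trans hb.2.le
  have hb₁N : 0 ≤ b₁ / N := div_nonneg hβ₁0 hN0.le
  obtain ⟨hρ0, hρ1⟩ := gaugeR_coef_lt_one (N := N) (R := R) hK0 hb₁N h925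
  have hκ : 0 < starRate (gaugeR (4 * (K * (b₁ / N)))) := starRate_pos hρ0 hρ1
  set ρ : ℝ := Real.exp (-(starRate (gaugeR (4 * (K * (b₁ / N)))) / 16)) with hρ
  set B : ℝ := (N : ℝ) * (2 * (4 * (2 * Real.sqrt N) ^ 2 * Real.exp (starRate (gaugeR (4 * (K * (b₁ / N)))) * (D + 4)) *
    (4 * (4 * (N : ℝ) ^ 3) * (((Λ.card : ℝ) + 4) * (4 * (N : ℝ) ^ 3 * (|F 1| + 2 * KF) + KF)) +
      16 * (|F 1| + 2 * KF) * (4 * (N : ℝ) ^ 3) ^ 2 + 24 * (4 * (N : ℝ) ^ 3) * ((Λ.card : ℝ) * KF))) *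
    (numOrient 4 * ((1 + ρ) / (1 - ρ)) ^ 4)) with hB
  have hρ0' : 0 ≤ ρ := (Real.exp_pos _).le
  have hρ1' : ρ < 1 := Real.exp_lt_one_iff.2 (by linarith)
  have hK0' : (0 : ℝ) ≤ KF := KF.2
  have hB0 : 0 ≤ B := by
    have : 0 < 1 - ρ := by linarith
    positivity
  have hbI : b ∈ Icc (0 : ℝ) b₁ := ⟨hb.1.le, hb.2.le⟩
  refine hasDerivAt_tsum_of_isPreconnected (summable_and_tsum_base_le (d := 4) hB0 hρ0' hρ1' x₀).1 isOpen_Ioo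
    (convex_Ioo (0 : ℝ) b₁).isPreconnected
    (fun q t ht => hasDerivAt_cov_plaquette_star_SU hN hK0 hmod hR h925 hμ hF hD q ht)
    (fun q t ht => ?_) hb (summable_cov_plaquette_star_SU hN hK0 hmod hR h925 hbI.1 hbI.2 (hμ b hbI) hF hD) hb
  have htI : t ∈ Icc (0 : ℝ) b₁ := ⟨ht.1.le, ht.2.le⟩
  obtain ⟨hs, hle⟩ := summable_threePoint_SU hN hK0 hmod hR h925 htI.1 htI.2 (hμ t htI) hF hD q
  rw [← hρ] at hle
  rw [norm_mul, Real.norm_eq_abs, abs_of_nonneg hN0.le, hB, mul_assoc (N : ℝ)]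
  refine mul_le_mul_of_nonneg_left ((norm_tsum_le_tsum_norm hs.norm).trans ?_) hN0.le
  simpa only [Real.norm_eq_abs] using hle

/-- ★★ **THE `SU(N)` STATE IS TWICE DIFFERENTIABLE IN THE COUPLING** (modulus window): along any DLR selection on `[0, b₁]`,
for every Lipschitz cylinder `F` and every `0 < b < b₁`:
`d²/db² ⟨F⟩_{μ b} = N · Σ_q N · Σ_r u₃(F; W_q; W_r)_{μ b}`. -/
theorem hasDerivAt_deriv_integral_star_SU (hN : 1 ≤ N) {R K b₁ : ℝ} (hK0 : 0 ≤ K) (hmod : OneLinkKRModulus N R K)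
    (hR : b₁ / N * 6 ≤ R) (h925 : 4 * (K * (b₁ / N)) ≤ 9 / 25)
    {μ : ℝ → Measure (LGConfig 4 (Matrix.specialUnitaryGroup (Fin N) ℂ))}
    (hμ : ∀ b ∈ Icc (0 : ℝ) b₁, μ b ∈ ymGibbsMeasures (d := 4) (fundamentalRep (Fin N)) b)
    {F : LGConfig 4 (Matrix.specialUnitaryGroup (Fin N) ℂ) → ℝ} {Λ : Finset (ZdEdge 4)} {KF : ℝ≥0}
    (hF : IsLipschitzCylinder (fundamentalRep (Fin N)) F Λ KF)
    {x₀ : Literature.Probability.LatticeModels.Site 4} {D : ℕ} (hD : ∀ e ∈ Λ, ‖e.1 - x₀‖ ≤ D)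
    {b : ℝ} (hb : b ∈ Ioo (0 : ℝ) b₁) :
    HasDerivAt (deriv fun t => ∫ U, F U ∂(μ t))
      ((N : ℝ) * ∑' q : ZdPlaquette 4, (N : ℝ) * ∑' r : ZdPlaquette 4, (cov[fun U => F U * (W∗ q) U, W∗ r; μ b] -
        (∫ U, F U ∂(μ b)) * cov[W∗ q, W∗ r; μ b] - (∫ U, (W∗ q) U ∂(μ b)) * cov[F, W∗ r; μ b])) b := by
  refine ((hasDerivAt_responseSum_star_SU hN hK0 hmod hR h925 hμ hF hD hb).const_mul (N : ℝ)).congr_of_eventuallyEq ?_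
  filter_upwards [Ioo_mem_nhds hb.1 hb.2] with t ht
  exact (hasDerivAt_integral_star_SU hN hK0 hmod hR h925 hμ hF hD ht).deriv

/-- **The double three-point sum is continuous in the coupling** on `[0, b₁]` (`SU(N)`, modulus window). -/
theorem continuousOn_threePointSum_SU (hN : 1 ≤ N) {R K b₁ : ℝ} (hK0 : 0 ≤ K) (hmod : OneLinkKRModulus N R K)
    (hR : b₁ / N * 6 ≤ R) (h925 : 4 * (K * (b₁ / N)) ≤ 9 / 25)
    {μ : ℝ → Measure (LGConfig 4 (Matrix.specialUnitaryGroup (Fin N) ℂ))}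
    (hμ : ∀ b ∈ Icc (0 : ℝ) b₁, μ b ∈ ymGibbsMeasures (d := 4) (fundamentalRep (Fin N)) b)
    {F : LGConfig 4 (Matrix.specialUnitaryGroup (Fin N) ℂ) → ℝ} {Λ : Finset (ZdEdge 4)} {KF : ℝ≥0}
    (hF : IsLipschitzCylinder (fundamentalRep (Fin N)) F Λ KF)
    {x₀ : Literature.Probability.LatticeModels.Site 4} {D : ℕ} (hD : ∀ e ∈ Λ, ‖e.1 - x₀‖ ≤ D) :
    ContinuousOn (fun t => ∑' q : ZdPlaquette 4, (N : ℝ) * ∑' r : ZdPlaquette 4,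
      (cov[fun U => F U * (W∗ q) U, W∗ r; μ t] - (∫ U, F U ∂(μ t)) * cov[W∗ q, W∗ r; μ t] -
        (∫ U, (W∗ q) U ∂(μ t)) * cov[F, W∗ r; μ t])) (Icc (0 : ℝ) b₁) := by
  classical
  rcases lt_or_ge b₁ 0 with hneg | hβ₁0
  · rw [Set.Icc_eq_empty (by simpa using hneg)]; exact continuousOn_empty _
  have hN0 : (0 : ℝ) < N := by exact_mod_cast (show 0 < N by omega)
  have hb₁N : 0 ≤ b₁ / N := div_nonneg hβ₁0 hN0.le
  obtain ⟨hρ0, hρ1⟩ := gaugeR_coef_lt_one (N := N) (R := R) hK0 hb₁N h925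
  have hκ : 0 < starRate (gaugeR (4 * (K * (b₁ / N)))) := starRate_pos hρ0 hρ1
  set ρ : ℝ := Real.exp (-(starRate (gaugeR (4 * (K * (b₁ / N)))) / 16)) with hρ
  set A : ℝ := 4 * (2 * Real.sqrt N) ^ 2 * Real.exp (starRate (gaugeR (4 * (K * (b₁ / N)))) * (D + 4)) *
    (4 * (4 * (N : ℝ) ^ 3) * (((Λ.card : ℝ) + 4) * (4 * (N : ℝ) ^ 3 * (|F 1| + 2 * KF) + KF)) +
      16 * (|F 1| + 2 * KF) * (4 * (N : ℝ) ^ 3) ^ 2 + 24 * (4 * (N : ℝ) ^ 3) * ((Λ.card : ℝ) * KF)) with hA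
  set B : ℝ := (N : ℝ) * (2 * A * (numOrient 4 * ((1 + ρ) / (1 - ρ)) ^ 4)) with hB
  have hρ0' : 0 ≤ ρ := (Real.exp_pos _).le
  have hρ1' : ρ < 1 := Real.exp_lt_one_iff.2 (by linarith)
  have hK0' : (0 : ℝ) ≤ KF := KF.2
  have hA0 : 0 ≤ A := by positivity
  have hB0 : 0 ≤ B := by
    have : 0 < 1 - ρ := by linarith
    positivity
  refine continuousOn_tsum (fun q => ?_) (summable_and_tsum_base_le (d := 4) hB0 hρ0' hρ1' x₀).1 (fun q t ht => ?_)
  · have hAq : 0 ≤ A * ρ ^ l1 (x₀ - q.1) := by positivity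
    have hsum : Summable fun r : ZdPlaquette 4 =>
        A * ρ ^ l1 (x₀ - q.1) * ρ ^ l1 (x₀ - r.1) + A * ρ ^ l1 (x₀ - q.1) * ρ ^ l1 (q.1 - r.1) :=
      (summable_and_tsum_base_le (d := 4) hAq hρ0' hρ1' x₀).1.add
        (summable_and_tsum_base_le (d := 4) hAq hρ0' hρ1' q.1).1
    refine continuousOn_const.mul
      (continuousOn_tsum (fun r => continuousOn_threePoint_SU hN hK0 hmod hR h925 hμ hF hD q r) hsum
        (fun r t ht => ?_))
    rw [Real.norm_eq_abs]
    have h := abs_threePoint_le_SU hN hK0 hmod hR h925 ht.1 ht.2 (hμ t ht) hF hD q r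
    rw [← hρ, ← hA] at h
    linarith
  · obtain ⟨hs, hle⟩ := summable_threePoint_SU hN hK0 hmod hR h925 ht.1 ht.2 (hμ t ht) hF hD q
    rw [← hρ, ← hA] at hle
    rw [norm_mul, Real.norm_eq_abs, abs_of_nonneg hN0.le, hB, mul_assoc (N : ℝ)]
    refine mul_le_mul_of_nonneg_left ((norm_tsum_le_tsum_norm hs.norm).trans ?_) hN0.le
    simpa only [Real.norm_eq_abs] using hle

/-- ★★ **`C²` IN THE COUPLING, `SU(N)`** (modulus window): along any DLR selection on `[0, b₁]` and for every Lipschitz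
cylinder observable `F`, `b ↦ ⟨F⟩_{μ b}` is `ContDiffOn ℝ 2` on `Ioo 0 b₁`. -/
theorem contDiffOn_two_integral_star_SU (hN : 1 ≤ N) {R K b₁ : ℝ} (hK0 : 0 ≤ K) (hmod : OneLinkKRModulus N R K)
    (hR : b₁ / N * 6 ≤ R) (h925 : 4 * (K * (b₁ / N)) ≤ 9 / 25)
    {μ : ℝ → Measure (LGConfig 4 (Matrix.specialUnitaryGroup (Fin N) ℂ))}
    (hμ : ∀ b ∈ Icc (0 : ℝ) b₁, μ b ∈ ymGibbsMeasures (d := 4) (fundamentalRep (Fin N)) b)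
    {F : LGConfig 4 (Matrix.specialUnitaryGroup (Fin N) ℂ) → ℝ} {Λ : Finset (ZdEdge 4)} {KF : ℝ≥0}
    (hF : IsLipschitzCylinder (fundamentalRep (Fin N)) F Λ KF)
    {x₀ : Literature.Probability.LatticeModels.Site 4} {D : ℕ} (hD : ∀ e ∈ Λ, ‖e.1 - x₀‖ ≤ D) :
    ContDiffOn ℝ 2 (fun t => ∫ U, F U ∂(μ t)) (Ioo (0 : ℝ) b₁) := by
  rw [show (2 : WithTop ℕ∞) = 1 + 1 from rfl, contDiffOn_succ_iff_deriv_of_isOpen isOpen_Ioo]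
  refine ⟨fun t ht => (hasDerivAt_integral_star_SU hN hK0 hmod hR h925 hμ hF hD ht).differentiableAt.differentiableWithinAt,
    fun h => absurd h (by simp), ?_⟩
  exact contDiffOn_one_of_hasDerivAt (fun t ht => hasDerivAt_deriv_integral_star_SU hN hK0 hmod hR h925 hμ hF hD ht)
    (continuousOn_const.mul (continuousOn_threePointSum_SU hN hK0 hmod hR h925 hμ hF hD))

/-- ★★ **EVERY `SU(N)`, `N ≥ 2`, HYPOTHESIS-FREE** (Bakry–Émery modulus, `b₁ = N·9/308`): along any DLR selection on
`[0, N·9/308]`, for every Lipschitz cylinder `F` and every `0 < b < N·9/308` ('t Hooft `b/N < 9/308`):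
`d²/db² ⟨F⟩_{μ b} = N · Σ_q N · Σ_r u₃(F; W_q; W_r)_{μ b}`. [folklore] -/
theorem hasDerivAt_deriv_integral_SU_thooft (hN : 2 ≤ N)
    {μ : ℝ → Measure (LGConfig 4 (Matrix.specialUnitaryGroup (Fin N) ℂ))}
    (hμ : ∀ b ∈ Icc (0 : ℝ) ((N : ℝ) * (9 / 308)), μ b ∈ ymGibbsMeasures (d := 4) (fundamentalRep (Fin N)) b)
    {F : LGConfig 4 (Matrix.specialUnitaryGroup (Fin N) ℂ) → ℝ} {Λ : Finset (ZdEdge 4)} {KF : ℝ≥0}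
    (hF : IsLipschitzCylinder (fundamentalRep (Fin N)) F Λ KF)
    {x₀ : Literature.Probability.LatticeModels.Site 4} {D : ℕ} (hD : ∀ e ∈ Λ, ‖e.1 - x₀‖ ≤ D)
    {b : ℝ} (hb : b ∈ Ioo (0 : ℝ) ((N : ℝ) * (9 / 308))) :
    HasDerivAt (deriv fun t => ∫ U, F U ∂(μ t))
      ((N : ℝ) * ∑' q : ZdPlaquette 4, (N : ℝ) * ∑' r : ZdPlaquette 4, (cov[fun U => F U * (W∗ q) U, W∗ r; μ b] -
        (∫ U, F U ∂(μ b)) * cov[W∗ q, W∗ r; μ b] - (∫ U, (W∗ q) U ∂(μ b)) * cov[F, W∗ r; μ b])) b := by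
  have hN0 : (0 : ℝ) < N := by exact_mod_cast (show 0 < N by omega)
  set b₁ : ℝ := (N : ℝ) * (9 / 308) with hb₁
  have hb₁N : b₁ / N = 9 / 308 := by rw [hb₁]; field_simp
  have hb₁0 : 0 ≤ b₁ := by positivity
  obtain ⟨h1, hK0, h4⟩ := StarSUN.bakryEmery_coef_le (by omega) hb₁0 hb₁N.le
  have hab : |b₁| / N = b₁ / N := by rw [abs_of_nonneg hb₁0]
  rw [hab] at h1 hK0 h4
  exact hasDerivAt_deriv_integral_star_SU (by omega) hK0 (oneLinkKRModulus_SU hN h1) le_rfl h4 hμ hF hD hb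

/-- ★★ **EVERY `SU(N)`, `N ≥ 2`, HYPOTHESIS-FREE: the strong-coupling state is `C²` in the coupling on `(0, N·9/308)`** on
every Lipschitz cylinder observable, along any DLR selection. [folklore] -/
theorem contDiffOn_two_integral_SU_thooft (hN : 2 ≤ N)
    {μ : ℝ → Measure (LGConfig 4 (Matrix.specialUnitaryGroup (Fin N) ℂ))}
    (hμ : ∀ b ∈ Icc (0 : ℝ) ((N : ℝ) * (9 / 308)), μ b ∈ ymGibbsMeasures (d := 4) (fundamentalRep (Fin N)) b)
    {F : LGConfig 4 (Matrix.specialUnitaryGroup (Fin N) ℂ) → ℝ} {Λ : Finset (ZdEdge 4)} {KF : ℝ≥0}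
    (hF : IsLipschitzCylinder (fundamentalRep (Fin N)) F Λ KF)
    {x₀ : Literature.Probability.LatticeModels.Site 4} {D : ℕ} (hD : ∀ e ∈ Λ, ‖e.1 - x₀‖ ≤ D) :
    ContDiffOn ℝ 2 (fun t => ∫ U, F U ∂(μ t)) (Ioo (0 : ℝ) ((N : ℝ) * (9 / 308))) := by
  have hN0 : (0 : ℝ) < N := by exact_mod_cast (show 0 < N by omega)
  set b₁ : ℝ := (N : ℝ) * (9 / 308) with hb₁
  have hb₁N : b₁ / N = 9 / 308 := by rw [hb₁]; field_simp
  have hb₁0 : 0 ≤ b₁ := by positivity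
  obtain ⟨h1, hK0, h4⟩ := StarSUN.bakryEmery_coef_le (by omega) hb₁0 hb₁N.le
  have hab : |b₁| / N = b₁ / N := by rw [abs_of_nonneg hb₁0]
  rw [hab] at h1 hK0 h4
  exact contDiffOn_two_integral_star_SU (by omega) hK0 (oneLinkKRModulus_SU hN h1) le_rfl h4 hμ hF hD

/-- ★ **EVERY `SU(N)`, `N ≥ 2`: the mean plaquette `u(b) = ⟨W_p⟩_b` is `C²` on `(0, N·9/308)`** with
`u''(b) = N Σ_q N Σ_r u₃(W_p; W_q; W_r)_b`, hypothesis-free — no first-, second- or third-order transition of the lattice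
internal energy in the window. [folklore] -/
theorem hasDerivAt_deriv_plaquette_SU_thooft (hN : 2 ≤ N)
    {μ : ℝ → Measure (LGConfig 4 (Matrix.specialUnitaryGroup (Fin N) ℂ))}
    (hμ : ∀ b ∈ Icc (0 : ℝ) ((N : ℝ) * (9 / 308)), μ b ∈ ymGibbsMeasures (d := 4) (fundamentalRep (Fin N)) b)
    (p : ZdPlaquette 4) {b : ℝ} (hb : b ∈ Ioo (0 : ℝ) ((N : ℝ) * (9 / 308))) :
    HasDerivAt (deriv fun t => ∫ U, (W∗ p) U ∂(μ t))
      ((N : ℝ) * ∑' q : ZdPlaquette 4, (N : ℝ) * ∑' r : ZdPlaquette 4, (cov[fun U => (W∗ p) U * (W∗ q) U, W∗ r; μ b] -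
        (∫ U, (W∗ p) U ∂(μ b)) * cov[W∗ q, W∗ r; μ b] - (∫ U, (W∗ q) U ∂(μ b)) * cov[W∗ p, W∗ r; μ b])) b :=
  hasDerivAt_deriv_integral_SU_thooft hN hμ (isLipschitzCylinder_zdPlaquetteObs (N := N) p.1 p.2.2) (x₀ := p.1) (D := 1)
    (fun e he => by simpa using norm_fst_sub_le_of_mem_plaquetteEdges he) hb

end Series

end Summit.Ventures.YMGap.CouplingResponse

end
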